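import Summits.QuantumFields.YangMills.Theorems.UnitScaleTiltProp8EulerLagrangeRegPr
import Summits.QuantumFields.YangMills.Theorems.UnitScaleTiltProp8IterPlaqSmallAllL
import HarnessLib

/-!
# Route `UnitScaleTilt`, crux K1 «MinimiserStabilityRegPr» (stmt-QuantumFields-19200), registered stub V2′ `stub_halvingStep` — sub-lemma EL for EVERY
# BLOCK SIZE: **THE k-FOLD EULER–LAGRANGE EQUATIONS OF AN R2-CRITICAL CONFIGURATION OF (6)(ε₀), `L ∈ {3, 5}` INCLUDED**

Cell `ym3-torus` (HUMAN RULING D-0037, YM ladder rung R3 — continuum SU(2) YM₃ on the torus is a RUNG, not the Clay problem), width seat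
`ym-ust-19200-w3` gen 0.  `--supports stmt-QuantumFields-19200 --as helper`; def-free, 0 sorry, standard axioms.

WHY.  The item stmt-QuantumFields-19200 is EVERY odd block size `L > 1` (V8-VET-CHECKLIST item 9: «no `7 ≤ L` binder inside any registered text»).
★ym-ust-19200-p2 g5's carrier forms of the k-fold Euler–Lagrange equation of an R2-critical configuration — `Prop8Criticality.
exists_tangent_lin_eq_zero_of_isCritR2_iter_regPr` / `…_family_regPr` (p534319), the input of [Balaban1985Variational] (158) («We will use only the fact
that they are critical configurations of the functional (5) and that they belong to the spaces (6) with ε₀ sufficiently small», p. 300) — carry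
`7 ≤ F.L`, because their smallness datum `t0_data_of_regPr` came from `IterPlaqSmall.plaqSmall_iter_T3_lt` (`L ≥ 7`).  Since then ym3-torus-p1 g18
landed the ALL-`L` multi-level plaquette smallness `IterPlaqSmallAllL.plaqSmall_iter_T3_allL` (p577141; axial gauge on the 4-block cluster, every `L`).
THIS FILE re-derives the smallness datum from it and restates the two E–L theorems WITHOUT the block-size threshold: hypotheses `IsCritR2`,
`RegPr F n K ε₀ U₀`, `0 < ε₀`, `10¹⁰·L⁶·ε₀ ≤ 1` (one polynomial smallness replacing `2·10⁸L³ε₀ ≤ 1 ∧ 7 ≤ L`).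

* `t0_data_of_regPr_allL` — with `t₀ := (10800L + 1)·ε₀`: `0 < t₀`, `stokesConst·t₀ ≤ emlWeight/1000` (`stokesConst = 25L²/4`, `emlWeight = (36L³)⁻¹`
  at the carrier; `225000·L⁵(10800L + 1) ≤ 10¹⁰L⁶`), and every iterated (0.4)-average `Ū₀^{(i)}`, `i < K − n`, is `t₀`-small
  (`plaqSmall_iter_T3_allL`: size `(10800L+1)·L^{2i}·ε₀L^{−2(K−n)} ≤ t₀`).
* `exists_tangent_lin_eq_zero_of_isCritR2_iter_regPr_allL`, `exists_tangent_lin_eq_zero_of_isCritR2_family_regPr_allL` — p2 g5's two theorems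
  (p516212 / p526705 by name) with the all-`L` datum.

HONEST SCOPE: bookkeeping over landed theorems (no new estimate); constants not optimised.  No definition, no sorry, standard axioms.
NOT a claim about the crux, the rung, or the mass gap.

References: T. Bałaban, CMP **102** (1985) 277–309 [Balaban1985Variational] ((2), (6) p.278, (127) p.297, p.300, (146) p.301, (158) p.302, Prop. 8 p.304).
-/

noncomputable section

open scoped BigOperators Matrix.Norms.L2Operator Matrix Topology
open Filter Function Asymptotics NormedSpace

namespace Summit.QuantumFields.YangMills.Theorems.Prop8CriticalityAllL

open Literature.MathematicalPhysics.QuantumFieldTheory.Balaban1983to89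
open T4Continuum AveragingRT BlockAveraging BlockAveragingHaarAC BlockAveragingEMLHaarAC ExpMeanLog
open Summit.QuantumFields.YangMills.Theorems.BlockAvgCorrector (stokesConst stokesConst_nonneg emlWeight_pos emlWeight_le_one stokesConst_T3 emlWeight_T3)
open T3ContinuumYM3Torus T3UnitLawDensityEML T3ConstrainedMinimiser T3TiltDescent T3DescentFibreTower T3LevelShift
open T3PrintedRegularMinimiser T3RegularMinimiser T3Thm1CarrierNative T3PrintedMinimiserExistence
open BlockAveragingEMLHaarAC (emlWeight)
open Summit.QuantumFields.YangMills.Theorems.IterPlaqSmallAllL (plaqSmall_iter_T3_allL)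
open Summit.QuantumFields.YangMills.Theorems.Prop8Criticality (exists_tangent_lin_eq_zero_of_isCritR2_iter exists_tangent_lin_eq_zero_of_isCritR2_family)

/-- **THE SMALLNESS DATA OF THE k-FOLD E–L THEOREMS FROM `U₀ ∈ 𝔘_k(ε₀)`, EVERY BLOCK SIZE** (`0 < ε₀`, `10¹⁰L⁶ε₀ ≤ 1`): with `t₀ := (10800L + 1)ε₀` one has
`0 < t₀`, `stokesConst·t₀ ≤ emlWeight/1000`, and every iterated average `Ū₀^{(i)}`, `i < K − n`, is `t₀`-small (p1 g18's `plaqSmall_iter_T3_allL`).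
[cite: Balaban1985Variational, (2) p.278 and (146) p.301] -/
theorem t0_data_of_regPr_allL (F : T3Family) {n K : ℕ} {ε₀ : ℝ} (hε₀ : 0 < ε₀)
    (hε : 10 ^ 10 * (F.L : ℝ) ^ 6 * ε₀ ≤ 1) {U₀ : GaugeField (F.P K) 0 (Matrix.specialUnitaryGroup (Fin 2) ℂ)}
    (hU₀reg : RegPr F n K ε₀ U₀) :
    0 < (10800 * (F.L : ℝ) + 1) * ε₀ ∧
      stokesConst (F.P K) * ((10800 * (F.L : ℝ) + 1) * ε₀) ≤ emlWeight (F.P K) / 1000 ∧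
      ∀ i, i < K - n → PlaqSmall ((10800 * (F.L : ℝ) + 1) * ε₀)
        (Averaging.iter (fun i => blockAvg (P := F.P K) (j := i) (expMeanLogSU (n := Fin 2))) i U₀) := by
  have hL1 : (1 : ℝ) ≤ F.L := by exact_mod_cast (le_of_lt F.hL.2)
  have hL0 : (0 : ℝ) < F.L := by linarith
  refine ⟨by positivity, ?_, ?_⟩
  · rw [stokesConst_T3, emlWeight_T3]
    rw [div_eq_mul_inv, ← one_div, le_div_iff₀ (by norm_num : (0 : ℝ) < 1000)]
    rw [show ((36 : ℝ) * (F.L : ℝ) ^ 3)⁻¹ = 1 / (36 * (F.L : ℝ) ^ 3) from (one_div _).symm, le_div_iff₀ (by positivity)]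
    -- `225000·L⁵·(10800L + 1)·ε₀ ≤ 10¹⁰·L⁶·ε₀ ≤ 1`
    have h5 : (F.L : ℝ) ^ 5 * (10800 * (F.L : ℝ) + 1) ≤ 10801 * (F.L : ℝ) ^ 6 := by nlinarith [pow_pos hL0 5]
    have h6 : 0 ≤ (F.L : ℝ) ^ 6 * ε₀ := by positivity
    nlinarith [pow_pos hL0 5, h5, h6]
  · intro i hik
    have hε7 : 10 ^ 7 * (F.L : ℝ) ^ 3 * ε₀ ≤ 1 := by
      refine le_trans ?_ hε
      have hL3 : (F.L : ℝ) ^ 3 ≤ (F.L : ℝ) ^ 6 := pow_le_pow_right₀ hL1 (by norm_num)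
      have : (10 : ℝ) ^ 7 * (F.L : ℝ) ^ 3 ≤ 10 ^ 10 * (F.L : ℝ) ^ 6 := by nlinarith [pow_pos hL0 3, hL3]
      exact mul_le_mul_of_nonneg_right this hε₀.le
    have h := plaqSmall_iter_T3_allL F n K hε₀ hε7 U₀ hU₀reg.plaqSmall i hik.le
    refine plaqSmall_of_le ?_ h
    refine mul_le_mul_of_nonneg_left ?_ (by positivity)
    -- `L^{2i}·ε₀·L^{−2(K−n)} ≤ ε₀` for `i ≤ K − n`
    show (F.L : ℝ) ^ (2 * i) * (ε₀ * ((F.L : ℝ)⁻¹) ^ (2 * (K - n))) ≤ ε₀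
    have hpow : (F.L : ℝ) ^ (2 * i) * ((F.L : ℝ)⁻¹) ^ (2 * (K - n)) ≤ 1 := by
      rw [inv_pow, ← div_eq_mul_inv, div_le_one (by positivity)]
      exact pow_le_pow_right₀ hL1 (by omega)
    calc (F.L : ℝ) ^ (2 * i) * (ε₀ * ((F.L : ℝ)⁻¹) ^ (2 * (K - n)))
        = ε₀ * ((F.L : ℝ) ^ (2 * i) * ((F.L : ℝ)⁻¹) ^ (2 * (K - n))) := by ring
      _ ≤ ε₀ * 1 := mul_le_mul_of_nonneg_left hpow hε₀.le
      _ = ε₀ := mul_one _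

/-- **THE k-FOLD E–L EQUATION FOR AN R2-CRITICAL `U₀ ∈ 𝔘_k(ε₀)`, ONE FINEST DIRECTION, EVERY BLOCK SIZE** — p516212's
`exists_tangent_lin_eq_zero_of_isCritR2_iter` with the `t₀`-hypotheses replaced by `RegPr F n K ε₀ U₀`, `0 < ε₀`, `10¹⁰L⁶ε₀ ≤ 1` (no `7 ≤ L`).
[cite: Balaban1985Variational, (127) p.297, (158) p.302, Prop 8 p.304] -/
theorem exists_tangent_lin_eq_zero_of_isCritR2_iter_regPr_allL (F : T3Family) {n K : ℕ} (hnK : n ≤ K)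
    {V : GaugeField (F.P n) 0 (Matrix.specialUnitaryGroup (Fin 2) ℂ)} {U₀ : GaugeField (F.P K) 0 (Matrix.specialUnitaryGroup (Fin 2) ℂ)}
    (hcrit : IsCritR2 F n K hnK V U₀)
    {ε₀ : ℝ} (hε₀ : 0 < ε₀) (hε : 10 ^ 10 * (F.L : ℝ) ^ 6 * ε₀ ≤ 1) (hU₀reg : RegPr F n K ε₀ U₀)
    (T : (i : ℕ) → Set (PBond (F.P K) i)) (hT : ∀ i, i < K - n → ∀ c : PBond (F.P K) (i + 1), c ∈ T (i + 1) → centralBond c ∈ T i)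
    (hTk : ∀ c : PBond (F.P K) (K - n), c ∈ T (K - n))
    (b₀ : PBond (F.P K) 0) (hb₀ : b₀ ∉ T 0)
    (g : ℝ → Matrix.specialUnitaryGroup (Fin 2) ℂ) (hg0 : g 0 = U₀ b₀) {D₀ : Matrix (Fin 2) (Fin 2) ℂ}
    (hg : HasDerivAt (fun t : ℝ => (g t : Matrix (Fin 2) (Fin 2) ℂ)) D₀ 0) :
    ∃ ξ : PBond (F.P K) 0 → Matrix (Fin 2) (Fin 2) ℂ,
      ξ b₀ = D₀ * star (U₀ b₀ : Matrix (Fin 2) (Fin 2) ℂ) ∧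
      (∀ b : PBond (F.P K) 0, b ≠ b₀ → b ∉ T 0 → ξ b = 0) ∧
      ∑ p : Plaq (F.P K) 0, (1 / 2) * ((((((GaugeField.plaqHol U₀ p : Matrix.specialUnitaryGroup (Fin 2) ℂ) : Matrix (Fin 2) (Fin 2) ℂ)) - 1)ᴴ
          * ((ξ ⟨p.src, p.μ⟩
              + (U₀ ⟨p.src, p.μ⟩ : Matrix (Fin 2) (Fin 2) ℂ) * ξ ⟨p.src.shift p.μ, p.ν⟩ * star (U₀ ⟨p.src, p.μ⟩ : Matrix (Fin 2) (Fin 2) ℂ)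
              - ((U₀ ⟨p.src, p.μ⟩ * U₀ ⟨p.src.shift p.μ, p.ν⟩ * (U₀ ⟨p.src.shift p.ν, p.μ⟩)⁻¹ : Matrix.specialUnitaryGroup (Fin 2) ℂ) : Matrix (Fin 2) (Fin 2) ℂ)
                  * ξ ⟨p.src.shift p.ν, p.μ⟩
                  * star ((U₀ ⟨p.src, p.μ⟩ * U₀ ⟨p.src.shift p.μ, p.ν⟩ * (U₀ ⟨p.src.shift p.ν, p.μ⟩)⁻¹ : Matrix.specialUnitaryGroup (Fin 2) ℂ) : Matrix (Fin 2) (Fin 2) ℂ)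
              - ((GaugeField.plaqHol U₀ p : Matrix.specialUnitaryGroup (Fin 2) ℂ) : Matrix (Fin 2) (Fin 2) ℂ) * ξ ⟨p.src, p.ν⟩
                  * star ((GaugeField.plaqHol U₀ p : Matrix.specialUnitaryGroup (Fin 2) ℂ) : Matrix (Fin 2) (Fin 2) ℂ))
            * ((GaugeField.plaqHol U₀ p : Matrix.specialUnitaryGroup (Fin 2) ℂ) : Matrix (Fin 2) (Fin 2) ℂ))).trace).re = 0 := by
  obtain ⟨ht₀, hsmall, hU₀⟩ := t0_data_of_regPr_allL F hε₀ hε hU₀reg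
  exact exists_tangent_lin_eq_zero_of_isCritR2_iter F hnK hcrit ht₀ hsmall hU₀ T hT hTk b₀ hb₀ g hg0 hg

/-- **THE k-FOLD E–L EQUATION FOR AN R2-CRITICAL `U₀ ∈ 𝔘_k(ε₀)` ALONG EVERY AMBIENT DIRECTION, EVERY BLOCK SIZE** — p526705's
`exists_tangent_lin_eq_zero_of_isCritR2_family` with the `t₀`-hypotheses replaced by `RegPr F n K ε₀ U₀`, `0 < ε₀`, `10¹⁰L⁶ε₀ ≤ 1` (no `7 ≤ L`).
[cite: Balaban1985Variational, (127) p.297, (158) p.302, Prop 8 p.304] -/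
theorem exists_tangent_lin_eq_zero_of_isCritR2_family_regPr_allL (F : T3Family) {n K : ℕ} (hnK : n ≤ K)
    {V : GaugeField (F.P n) 0 (Matrix.specialUnitaryGroup (Fin 2) ℂ)} {U₀ : GaugeField (F.P K) 0 (Matrix.specialUnitaryGroup (Fin 2) ℂ)}
    (hcrit : IsCritR2 F n K hnK V U₀)
    {ε₀ : ℝ} (hε₀ : 0 < ε₀) (hε : 10 ^ 10 * (F.L : ℝ) ^ 6 * ε₀ ≤ 1) (hU₀reg : RegPr F n K ε₀ U₀)
    (T : (i : ℕ) → Set (PBond (F.P K) i)) (hT : ∀ i, i < K - n → ∀ c : PBond (F.P K) (i + 1), c ∈ T (i + 1) → centralBond c ∈ T i)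
    (hTk : ∀ c : PBond (F.P K) (K - n), c ∈ T (K - n))
    (Γ₀ : ℝ → GaugeField (F.P K) 0 (Matrix.specialUnitaryGroup (Fin 2) ℂ)) (hΓ₀0 : Γ₀ 0 = U₀)
    (hΓ₀diff : ∀ b : PBond (F.P K) 0, DifferentiableAt ℝ (fun t : ℝ => (Γ₀ t b : Matrix (Fin 2) (Fin 2) ℂ)) 0) :
    ∃ ξ : PBond (F.P K) 0 → Matrix (Fin 2) (Fin 2) ℂ,
      (∀ b : PBond (F.P K) 0, b ∉ T 0 →
        HasDerivAt (fun t : ℝ => (Γ₀ t b : Matrix (Fin 2) (Fin 2) ℂ) * star (U₀ b : Matrix (Fin 2) (Fin 2) ℂ)) (ξ b) 0) ∧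
      ∑ p : Plaq (F.P K) 0, (1 / 2) * ((((((GaugeField.plaqHol U₀ p : Matrix.specialUnitaryGroup (Fin 2) ℂ) : Matrix (Fin 2) (Fin 2) ℂ)) - 1)ᴴ
          * ((ξ ⟨p.src, p.μ⟩
              + (U₀ ⟨p.src, p.μ⟩ : Matrix (Fin 2) (Fin 2) ℂ) * ξ ⟨p.src.shift p.μ, p.ν⟩ * star (U₀ ⟨p.src, p.μ⟩ : Matrix (Fin 2) (Fin 2) ℂ)
              - ((U₀ ⟨p.src, p.μ⟩ * U₀ ⟨p.src.shift p.μ, p.ν⟩ * (U₀ ⟨p.src.shift p.ν, p.μ⟩)⁻¹ : Matrix.specialUnitaryGroup (Fin 2) ℂ) : Matrix (Fin 2) (Fin 2) ℂ)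
                  * ξ ⟨p.src.shift p.ν, p.μ⟩
                  * star ((U₀ ⟨p.src, p.μ⟩ * U₀ ⟨p.src.shift p.μ, p.ν⟩ * (U₀ ⟨p.src.shift p.ν, p.μ⟩)⁻¹ : Matrix.specialUnitaryGroup (Fin 2) ℂ) : Matrix (Fin 2) (Fin 2) ℂ)
              - ((GaugeField.plaqHol U₀ p : Matrix.specialUnitaryGroup (Fin 2) ℂ) : Matrix (Fin 2) (Fin 2) ℂ) * ξ ⟨p.src, p.ν⟩
                  * star ((GaugeField.plaqHol U₀ p : Matrix.specialUnitaryGroup (Fin 2) ℂ) : Matrix (Fin 2) (Fin 2) ℂ))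
            * ((GaugeField.plaqHol U₀ p : Matrix.specialUnitaryGroup (Fin 2) ℂ) : Matrix (Fin 2) (Fin 2) ℂ))).trace).re = 0 := by
  obtain ⟨ht₀, hsmall, hU₀⟩ := t0_data_of_regPr_allL F hε₀ hε hU₀reg
  exact exists_tangent_lin_eq_zero_of_isCritR2_family F hnK hcrit ht₀ hsmall hU₀ T hT hTk Γ₀ hΓ₀0 hΓ₀diff

end Summit.QuantumFields.YangMills.Theorems.Prop8CriticalityAllL

end
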